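/-
Copyright: the b2b-balaban T⁴-continuum CRUX team, row NE7b OWNER lineage `t4-ne7b-p1` (gen 137). Project licence.
-/
import Summits.QuantumFields.BalabanUV.T4Continuum.Spine.NE7b.SupBlockThirdCentred

/-!
# THE UNIFORM THIRD-ORDER LETTER `κ₃⁺` — THE LAST LETTER OF THE CLASS, the class-closure plan, item (d), completed.  For a `C³` block input `U`
# with the four block letters, the secant lower letter `λ ≥ 0` on all sites and `M ≻ 0` of floor `m > λ`: the third Fréchet derivative
# `T(ψ)` of `W = −log Z` ((419)) satisfies, at EVERY background `ψ` and UNIFORMLY in `ψ` and in the volume,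
#   `‖T(ψ)‖ ≤ κ₃⁺ := κ₃ + 3κ₂²∕2 + 2κ₂²∕(m−λ) + 5κ₂⁴∕(2(m−λ)²)`
# — by (425)'s centred form `T[h,k,l] = E_ν[C − (A_k−a_k)B_hl − B_hk(A_l−a_l) − (A_h−a_h)B_kl + Π(A−a)]`, the elementary inequalities
# `|xy| ≤ ½x² + ½y²`, `|xyz| ≤ ½x² + ¼(y⁴+z⁴)`, and (423)'s CONCENTRATION letters `Var_ν(A_v) ≤ κ₂²∕(m−λ)`, `E_ν(A_v−a_v)⁴ ≤ 5κ₂⁴∕(m−λ)²`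
# for unit `v` (Brascamp–Lieb through (421)∕(422)), `|B_vw| ≤ κ₂`, `|C| ≤ κ₃`; so the output single-block potential `w⁺` ((415)) has
# `‖(w⁺)‴(ζ)‖ = ‖T(ψ₀+ζ)‖ ≤ κ₃⁺` — the input format's `hU₃b` REGENERATED, with a constant that does NOT grow with the background (the raw
# letter of (406)∕(407) grew like `e^{O(Σ_Yψ²)}`) (row NE7b, node U5c; (419)∕(423)∕(425) BY NAME; [folklore] + [cite: BrascampLieb1976, Thm 4.1]
# through (422))

Cell `pub-balaban`, sub-cell `t4`, spine estimate NE7b (`T4WeightBudget.RelWeightBound`; the cell's OWN estimate — NOT PRINTED in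
[Bałaban 1983–89], NOT PROVED).  Crux-route work under `Spine/NE7b/` by the row OWNER (`t4-ne7b-p1` gen 137, file (426)) under FREEZE
(0)'s crux-prover clause (this gen's class-closure audit, item (d)); NOTHING of Bałaban's is named as a Lean object, valued or asserted; no
`T4Continuum/Support` leaf typed; no `def`, no notation; zero `sorry`.  Imports (BY NAME): the OWNER's (425) `…SupBlockThirdCentred`
(`hessW_deriv_apply_centred`, `integrable_scalar_pieces`) and through it (423) (`integrable_block_moments`, `tilted_variance_eq`,
`block_tilted_variance_le`, `block_tilted_fourth_moment_le`), (399) (`integrable_exp_neg_block`); Mathlib's `abs_integral_le_integral_abs`,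
`integral_mono_of_nonneg`, `ContinuousLinearMap.opNorm_le_of_unit_norm`.

WHAT IS PROVED ([folklore]):
* §1 `abs_mul_le_half_sq`, `abs_mul3_le`, `psi_abs_le` (the pointwise majorant of the centred integrand), `integral_majorant_split`
  (ten-piece linearity, generic), `assembly_arith` (the real arithmetic of the assembly);
* §2 `integrable_centred_pieces`, `tilted_centred_letters` (the tilted integrals of the majorant's pieces for unit directions);
* §3 `centred_integral_abs_le`, **`third_deriv_apply_le`** (`|T(ψ)[h,k,l]| ≤ κ₃⁺` for `‖h‖ = ‖k‖ = ‖l‖ = 1`), THE END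
  **`third_letter_uniform`** (`‖T(ψ)‖ ≤ κ₃⁺`).

HONEST (what this is NOT).  A crude but UNIFORM constant (AM–GM in place of Hölder; the Poincaré constant `(m−λ)⁻¹` from the global secant
letter); the assembly «the fluctuation step is a self-map of the block class» is the successor file; no contraction ((β4)), no
decaying-covariance polymer expansion ((β3′)); scalar skeleton ((A3), NC-NE7b-α UNRULED); nothing of Bałaban's asserted.  BY-NAME EFFECT ON
THE WALL: NONE.  NE7b NOT PRINTED ∕ NOT PROVED; spine PROVED 0∕9; rung (B)+1 — the programme's measures remain FINITE-torus statements; NOT the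
mass gap, NOT Clay.  HONEST DEPENDENCY: continuum YM on T⁴ ⇐ BetaPertH ∧ nine spine estimates (0∕9 proved); BetaPertH ⇐ (D1) ∧ (D4) ∧
CAP+tail; G-an2-4 gates asym, D1 and NE2∕3∕4.
-/

set_option autoImplicit false
set_option maxSynthPendingDepth 3

noncomputable section

namespace Summit.QuantumFields.BalabanUV.T4Continuum.NE7b.SupBlockThirdLetterUniform

open MeasureTheory ProbabilityTheory Finset Real
open scoped BigOperators Matrix
open SupEffectiveActionDerivative (mul_opBound_le_of_le)
open SupBlockEffectiveActionDerivative (integrable_exp_neg_block)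
open SupBlockFourthMoment (integrable_block_moments tilted_variance_eq block_tilted_variance_le block_tilted_fourth_moment_le)
open SupBlockThirdCentred (hessW_deriv_apply_centred integrable_scalar_pieces)

variable {ι : Type} [Fintype ι] [DecidableEq ι]

/-! ## §1. Pointwise majorants, generic linearity, the assembly arithmetic -/

/-- `|xy| ≤ ½x² + ½y²`. [folklore] -/
theorem abs_mul_le_half_sq (x y : ℝ) : |x * y| ≤ x ^ 2 / 2 + y ^ 2 / 2 := by
  rw [abs_mul]; nlinarith [sq_nonneg (|x| - |y|), sq_abs x, sq_abs y, abs_nonneg x, abs_nonneg y]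

/-- `|xyz| ≤ ½x² + ¼(y⁴ + z⁴)`. [folklore] -/
theorem abs_mul3_le (x y z : ℝ) : |x * y * z| ≤ x ^ 2 / 2 + (y ^ 4 + z ^ 4) / 4 := by
  have h1 : |x * (y * z)| ≤ x ^ 2 / 2 + (y * z) ^ 2 / 2 := abs_mul_le_half_sq x (y * z)
  have h2 : (y * z) ^ 2 ≤ (y ^ 4 + z ^ 4) / 2 := by nlinarith [sq_nonneg (y ^ 2 - z ^ 2)]
  rw [mul_assoc]; linarith

/-- **The pointwise majorant of the centred integrand**: with `|C| ≤ c₃`,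
`|C − ÃkB₁ − B₂Ãl − ÃhB₃ + ÃhÃkÃl| ≤ c₃ + ½(Ãk²+B₁²) + ½(B₂²+Ãl²) + ½(Ãh²+B₃²) + ½Ãh² + ¼(Ãk⁴+Ãl⁴)`. [folklore] -/
theorem psi_abs_le {C c₃ Ah Ak Al B₁ B₂ B₃ : ℝ} (hC : |C| ≤ c₃) :
    |C - Ak * B₁ - B₂ * Al - Ah * B₃ + Ah * Ak * Al| ≤
      c₃ + (Ak ^ 2 + B₁ ^ 2) / 2 + (B₂ ^ 2 + Al ^ 2) / 2 + (Ah ^ 2 + B₃ ^ 2) / 2 + Ah ^ 2 / 2 + (Ak ^ 4 + Al ^ 4) / 4 := by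
  have h1 := abs_mul_le_half_sq Ak B₁
  have h2 := abs_mul_le_half_sq B₂ Al
  have h3 := abs_mul_le_half_sq Ah B₃
  have h4 := abs_mul3_le Ah Ak Al
  have t : |C - Ak * B₁ - B₂ * Al - Ah * B₃ + Ah * Ak * Al| ≤ |C| + |Ak * B₁| + |B₂ * Al| + |Ah * B₃| + |Ah * Ak * Al| := by
    have a1 := abs_add_le (C - Ak * B₁ - B₂ * Al - Ah * B₃) (Ah * Ak * Al)
    have a2 := abs_sub (C - Ak * B₁ - B₂ * Al) (Ah * B₃)
    have a3 := abs_sub (C - Ak * B₁) (B₂ * Al)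
    have a4 := abs_sub C (Ak * B₁)
    linarith
  linarith

/-- **Ten-piece linearity (generic)**: the integral of `e·(c + ½(x₁²+y₁²) + ½(y₂²+x₂²) + ½(x₃²+y₃²) + ½x₃² + ¼(x₁⁴+x₂⁴))` splits into the ten
integrals of its pieces, given their integrability. [folklore] -/
theorem integral_majorant_split {X : Type*} [MeasurableSpace X] (μ : Measure X) (e x1 x2 x3 y1 y2 y3 : X → ℝ) (c : ℝ)
    (he : Integrable e μ) (hx1 : Integrable (fun t => e t * x1 t ^ 2) μ) (hx2 : Integrable (fun t => e t * x2 t ^ 2) μ)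
    (hx3 : Integrable (fun t => e t * x3 t ^ 2) μ) (hy1 : Integrable (fun t => e t * y1 t ^ 2) μ) (hy2 : Integrable (fun t => e t * y2 t ^ 2) μ)
    (hy3 : Integrable (fun t => e t * y3 t ^ 2) μ) (hm1 : Integrable (fun t => e t * x1 t ^ 4) μ) (hm2 : Integrable (fun t => e t * x2 t ^ 4) μ) :
    Integrable (fun t => e t * (c + (x1 t ^ 2 + y1 t ^ 2) / 2 + (y2 t ^ 2 + x2 t ^ 2) / 2 + (x3 t ^ 2 + y3 t ^ 2) / 2 + x3 t ^ 2 / 2 + (x1 t ^ 4 + x2 t ^ 4) / 4)) μ ∧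
      ∫ t, e t * (c + (x1 t ^ 2 + y1 t ^ 2) / 2 + (y2 t ^ 2 + x2 t ^ 2) / 2 + (x3 t ^ 2 + y3 t ^ 2) / 2 + x3 t ^ 2 / 2 + (x1 t ^ 4 + x2 t ^ 4) / 4) ∂μ =
        c * (∫ t, e t ∂μ) + 1 / 2 * (∫ t, e t * x1 t ^ 2 ∂μ) + 1 / 2 * (∫ t, e t * y1 t ^ 2 ∂μ) + 1 / 2 * (∫ t, e t * y2 t ^ 2 ∂μ) + 1 / 2 * (∫ t, e t * x2 t ^ 2 ∂μ) + 1 /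
            2 * (∫ t, e t * x3 t ^ 2 ∂μ) + 1 / 2 * (∫ t, e t * y3 t ^ 2 ∂μ) + 1 / 2 * (∫ t, e t * x3 t ^ 2 ∂μ) + 1 / 4 * (∫ t, e t * x1 t ^ 4 ∂μ) + 1 / 4 * (∫ t, e t * x2 t
            ^ 4 ∂μ) := by
  have heq : (fun t => e t * (c + (x1 t ^ 2 + y1 t ^ 2) / 2 + (y2 t ^ 2 + x2 t ^ 2) / 2 + (x3 t ^ 2 + y3 t ^ 2) / 2 + x3 t ^ 2 / 2 + (x1 t ^ 4 + x2 t ^ 4) / 4)) =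
      fun t => c * e t + 1 / 2 * (e t * x1 t ^ 2) + 1 / 2 * (e t * y1 t ^ 2) + 1 / 2 * (e t * y2 t ^ 2) + 1 / 2 * (e t * x2 t ^ 2) + 1 / 2 * (e t * x3 t ^ 2) + 1 / 2 * (e t
          * y3 t ^ 2) + 1 / 2 * (e t * x3 t ^ 2) + 1 / 4 * (e t * x1 t ^ 4) + 1 / 4 * (e t * x2 t ^ 4) := by
    funext t; ring
  have s2 : Integrable (fun t : X => c * e t + 1 / 2 * (e t * x1 t ^ 2)) μ := (he.const_mul c).add (hx1.const_mul (1 / 2))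
  have s3 : Integrable (fun t : X => c * e t + 1 / 2 * (e t * x1 t ^ 2) + 1 / 2 * (e t * y1 t ^ 2)) μ := s2.add (hy1.const_mul (1 / 2))
  have s4 : Integrable (fun t : X => c * e t + 1 / 2 * (e t * x1 t ^ 2) + 1 / 2 * (e t * y1 t ^ 2) + 1 / 2 * (e t * y2 t ^ 2)) μ := s3.add (hy2.const_mul (1 / 2))
  have s5 : Integrable (fun t : X => c * e t + 1 / 2 * (e t * x1 t ^ 2) + 1 / 2 * (e t * y1 t ^ 2) + 1 / 2 * (e t * y2 t ^ 2) + 1 / 2 * (e t * x2 t ^ 2)) μ := s4.add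
      (hx2.const_mul (1 / 2))
  have s6 : Integrable (fun t : X => c * e t + 1 / 2 * (e t * x1 t ^ 2) + 1 / 2 * (e t * y1 t ^ 2) + 1 / 2 * (e t * y2 t ^ 2) + 1 / 2 * (e t * x2 t ^ 2) + 1 / 2 * (e t * x3
      t ^ 2)) μ := s5.add (hx3.const_mul (1 / 2))
  have s7 : Integrable (fun t : X => c * e t + 1 / 2 * (e t * x1 t ^ 2) + 1 / 2 * (e t * y1 t ^ 2) + 1 / 2 * (e t * y2 t ^ 2) + 1 / 2 * (e t * x2 t ^ 2) + 1 / 2 * (e t * x3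
      t ^ 2) + 1 / 2 * (e t * y3 t ^ 2)) μ := s6.add (hy3.const_mul (1 / 2))
  have s8 : Integrable (fun t : X => c * e t + 1 / 2 * (e t * x1 t ^ 2) + 1 / 2 * (e t * y1 t ^ 2) + 1 / 2 * (e t * y2 t ^ 2) + 1 / 2 * (e t * x2 t ^ 2) + 1 / 2 * (e t * x3
      t ^ 2) + 1 / 2 * (e t * y3 t ^ 2) + 1 / 2 * (e t * x3 t ^ 2)) μ := s7.add (hx3.const_mul (1 / 2))
  have s9 : Integrable (fun t : X => c * e t + 1 / 2 * (e t * x1 t ^ 2) + 1 / 2 * (e t * y1 t ^ 2) + 1 / 2 * (e t * y2 t ^ 2) + 1 / 2 * (e t * x2 t ^ 2) + 1 / 2 * (e t * x3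
      t ^ 2) + 1 / 2 * (e t * y3 t ^ 2) + 1 / 2 * (e t * x3 t ^ 2) + 1 / 4 * (e t * x1 t ^ 4)) μ := s8.add (hm1.const_mul (1 / 4))
  refine ⟨heq ▸ s9.add (hm2.const_mul (1 / 4)), ?_⟩
  rw [heq, integral_add s9 (hm2.const_mul (1 / 4)), integral_add s8 (hm1.const_mul (1 / 4)), integral_add s7 (hx3.const_mul (1 / 2)), integral_add s6 (hy3.const_mul (1 /
      2)), integral_add s5 (hx3.const_mul (1 / 2)), integral_add s4 (hx2.const_mul (1 / 2)), integral_add s3 (hy2.const_mul (1 / 2)), integral_add s2 (hy1.const_mul (1 /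
      2)), integral_add (he.const_mul c) (hx1.const_mul (1 / 2))]
  simp only [integral_const_mul]

/-- **The real arithmetic of the assembly**. [folklore] -/
theorem assembly_arith {Z J c₃ K V F Ik Il Ih B1 B2 B3 Mk Ml : ℝ} (hZ : 0 < Z)
    (hJ : J ≤ c₃ * Z + 1 / 2 * Ik + 1 / 2 * B1 + 1 / 2 * B2 + 1 / 2 * Il + 1 / 2 * Ih + 1 / 2 * B3 + 1 / 2 * Ih + 1 / 4 * Mk + 1 / 4 * Ml)
    (hk : Z⁻¹ * Ik ≤ V) (hB1 : Z⁻¹ * B1 ≤ K) (hB2 : Z⁻¹ * B2 ≤ K) (hl : Z⁻¹ * Il ≤ V) (hh : Z⁻¹ * Ih ≤ V) (hB3 : Z⁻¹ * B3 ≤ K)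
    (hMk : Z⁻¹ * Mk ≤ F) (hMl : Z⁻¹ * Ml ≤ F) : Z⁻¹ * J ≤ c₃ + 3 * K / 2 + 2 * V + F / 2 := by
  have h := mul_le_mul_of_nonneg_left hJ (inv_nonneg.2 hZ.le)
  have hZi : Z⁻¹ * Z = 1 := inv_mul_cancel₀ hZ.ne'
  have hex : Z⁻¹ * (c₃ * Z + 1 / 2 * Ik + 1 / 2 * B1 + 1 / 2 * B2 + 1 / 2 * Il + 1 / 2 * Ih + 1 / 2 * B3 + 1 / 2 * Ih + 1 / 4 * Mk + 1 / 4 * Ml) =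
      c₃ * (Z⁻¹ * Z) + 1 / 2 * (Z⁻¹ * Ik) + 1 / 2 * (Z⁻¹ * B1) + 1 / 2 * (Z⁻¹ * B2) + 1 / 2 * (Z⁻¹ * Il) + 1 / 2 * (Z⁻¹ * Ih) + 1 / 2 * (Z⁻¹ * B3) +
        1 / 2 * (Z⁻¹ * Ih) + 1 / 4 * (Z⁻¹ * Mk) + 1 / 4 * (Z⁻¹ * Ml) := by ring
  rw [hex, hZi] at h
  linarith

section Main

variable {M : Matrix ι ι ℝ} {γop m lam : ℝ} {U : EuclideanSpace ℝ ι → ℝ} {U' : EuclideanSpace ℝ ι → EuclideanSpace ℝ ι →L[ℝ] ℝ}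
  {U'' : EuclideanSpace ℝ ι → EuclideanSpace ℝ ι →L[ℝ] EuclideanSpace ℝ ι →L[ℝ] ℝ}
  {U₃ : EuclideanSpace ℝ ι → EuclideanSpace ℝ ι →L[ℝ] EuclideanSpace ℝ ι →L[ℝ] EuclideanSpace ℝ ι →L[ℝ] ℝ} {κ₀ κ₁ κ₂ κ₃ a τ δ θ : ℝ}

/-! ## §2. The majorant's pieces: integrability and tilted letters for unit directions -/

/-- **The centred pieces are integrable**: `e(A_v−a_v)²`, `e·B_vw²`, `e(A_v−a_v)⁴` (domination by `2eA²+2a²e`, `κ₂²‖v‖²‖w‖²e`, `8eA⁴+8a⁴e`).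
[folklore] -/
theorem integrable_centred_pieces (hM : M.PosDef) (hΓop : (γop • (1 : Matrix ι ι ℝ) - M⁻¹).PosSemidef) (Y : Finset ι)
    (hUd : ∀ φ : EuclideanSpace ℝ ι, HasFDerivAt U (U' φ) φ) (hU'd : ∀ φ : EuclideanSpace ℝ ι, HasFDerivAt U' (U'' φ) φ)
    (hU''d : ∀ φ : EuclideanSpace ℝ ι, HasFDerivAt U'' (U₃ φ) φ) (hU₃c : Continuous U₃) (hκ₀ : 0 ≤ κ₀) (hκ₁ : 0 ≤ κ₁) (ha : 0 ≤ a) (hτ : 0 < τ) (hδ : 0 < δ)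
    (hθ0 : 0 < θ) (hθ1 : θ < 1) (hκθ : (2 * κ₀ * (1 + τ) + 4 * δ) * γop ≤ θ) (hstab : ∀ φ : EuclideanSpace ℝ ι, -(κ₀ * ∑ x ∈ Y, φ x ^ 2) ≤ U φ)
    (hU'b : ∀ φ : EuclideanSpace ℝ ι, ‖U' φ‖ ≤ κ₁ * (a + ∑ x ∈ Y, φ x ^ 2)) (hU''b : ∀ φ : EuclideanSpace ℝ ι, ‖U'' φ‖ ≤ κ₂)
    (hU₃b : ∀ φ : EuclideanSpace ℝ ι, ‖U₃ φ‖ ≤ κ₃) (ψ : EuclideanSpace ℝ ι) :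
    (∀ v : EuclideanSpace ℝ ι, Integrable (fun ω : EuclideanSpace ℝ ι => exp (-U (ω + ψ)) * (U' (ω + ψ) v - ((∫ ω : EuclideanSpace ℝ ι, exp (-U (ω + ψ))
        ∂(multivariateGaussian 0 M⁻¹))⁻¹ * (∫ ω : EuclideanSpace ℝ ι, exp (-U (ω + ψ)) * U' (ω + ψ) v ∂(multivariateGaussian 0 M⁻¹)))) ^ 2) (multivariateGaussian 0 M⁻¹)) ∧
      (∀ v w : EuclideanSpace ℝ ι, Integrable (fun ω : EuclideanSpace ℝ ι => exp (-U (ω + ψ)) * (U'' (ω + ψ) v w) ^ 2) (multivariateGaussian 0 M⁻¹)) ∧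
      (∀ v : EuclideanSpace ℝ ι, ‖v‖ = 1 → Integrable (fun ω : EuclideanSpace ℝ ι => exp (-U (ω + ψ)) * (U' (ω + ψ) v - ((∫ ω : EuclideanSpace ℝ ι, exp (-U (ω + ψ))
          ∂(multivariateGaussian 0 M⁻¹))⁻¹ * (∫ ω : EuclideanSpace ℝ ι, exp (-U (ω + ψ)) * U' (ω + ψ) v ∂(multivariateGaussian 0 M⁻¹)))) ^ 4) (multivariateGaussian 0 M⁻¹))
          := by
  have hΓ : (M⁻¹).PosSemidef := hM.inv.posSemidef
  have hU''c : Continuous U'' := continuous_iff_continuousAt.2 fun φ => (hU''d φ).continuousAt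
  have hU'c : Continuous U' := continuous_iff_continuousAt.2 fun φ => (hU'd φ).continuousAt
  have hUc : Continuous U := continuous_iff_continuousAt.2 fun φ => (hUd φ).continuousAt
  have hκθ₀ : 2 * κ₀ * (1 + τ) * γop ≤ θ := mul_opBound_le_of_le (by positivity) (by linarith) hθ0.le hκθ
  have hI := integrable_exp_neg_block hΓ hΓop Y hUc.measurable hκ₀ hτ hθ1 hκθ₀ hstab ψ
  have hsh : Continuous fun ω : EuclideanSpace ℝ ι => ω + ψ := continuous_id.add continuous_const
  have hEc : Continuous fun ω : EuclideanSpace ℝ ι => exp (-U (ω + ψ)) := continuous_exp.comp ((hUc.comp hsh).neg)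
  have hAc : ∀ v : EuclideanSpace ℝ ι, Continuous fun ω : EuclideanSpace ℝ ι => U' (ω + ψ) v := fun v => (hU'c.comp hsh).clm_apply continuous_const
  have hBc : ∀ v w : EuclideanSpace ℝ ι, Continuous fun ω : EuclideanSpace ℝ ι => U'' (ω + ψ) v w := fun v w =>
    ((hU''c.comp hsh).clm_apply continuous_const).clm_apply continuous_const
  obtain ⟨-, -, i4⟩ := integrable_block_moments hΓ hΓop Y hUd hU'c hκ₀ hκ₁ ha hτ hδ hθ1 hκθ hstab hU'b ψ
  obtain ⟨-, -, -, -, iAA, -⟩ := integrable_scalar_pieces hM hΓop Y hUd hU'd hU''d hU₃c hκ₀ hκ₁ ha hτ hδ hθ0 hθ1 hκθ hstab hU'b hU''b hU₃b ψ ψ ψ ψ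
  have hAb : ∀ (v : EuclideanSpace ℝ ι) (ω : EuclideanSpace ℝ ι), |U' (ω + ψ) v| ≤ ‖U' (ω + ψ)‖ * ‖v‖ := fun v ω => by
    rw [← Real.norm_eq_abs]; exact ContinuousLinearMap.le_opNorm _ _
  have hBb : ∀ (v w : EuclideanSpace ℝ ι) (ω : EuclideanSpace ℝ ι), |U'' (ω + ψ) v w| ≤ κ₂ * ‖v‖ * ‖w‖ := fun v w ω => by
    rw [← Real.norm_eq_abs]
    calc ‖U'' (ω + ψ) v w‖ ≤ ‖U'' (ω + ψ)‖ * ‖v‖ * ‖w‖ := ContinuousLinearMap.le_opNorm₂ _ _ _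
      _ ≤ κ₂ * ‖v‖ * ‖w‖ := by gcongr; exact hU''b _
  refine ⟨fun v => ?_, fun v w => ?_, fun v hv => ?_⟩
  · refine (((iAA v v).const_mul 2).add (hI.const_mul (2 * ((∫ ω : EuclideanSpace ℝ ι, exp (-U (ω + ψ)) ∂(multivariateGaussian 0 M⁻¹))⁻¹ * (∫ ω : EuclideanSpace ℝ ι, exp
      (-U (ω + ψ)) * U' (ω + ψ) v ∂(multivariateGaussian 0 M⁻¹))) ^ 2))).mono' ((hEc.mul (((hAc v).sub continuous_const).pow 2)).aestronglyMeasurable)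
      (ae_of_all _ fun ω => ?_)
    rw [Real.norm_eq_abs, abs_of_nonneg (mul_nonneg (exp_pos _).le (sq_nonneg _)), Pi.add_apply]
    nlinarith [exp_pos (-U (ω + ψ)), sq_nonneg (U' (ω + ψ) v + ((∫ ω : EuclideanSpace ℝ ι, exp (-U (ω + ψ)) ∂(multivariateGaussian 0 M⁻¹))⁻¹ * (∫ ω : EuclideanSpace ℝ ι,
        exp (-U (ω + ψ)) * U' (ω + ψ) v ∂(multivariateGaussian 0 M⁻¹)))), mul_nonneg (exp_pos (-U (ω + ψ))).le (sq_nonneg (U' (ω + ψ) v + ((∫ ω : EuclideanSpace ℝ ι, exp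
        (-U (ω + ψ)) ∂(multivariateGaussian 0 M⁻¹))⁻¹ * (∫ ω : EuclideanSpace ℝ ι, exp (-U (ω + ψ)) * U' (ω + ψ) v ∂(multivariateGaussian 0 M⁻¹)))))]
  · refine (hI.const_mul ((κ₂ * ‖v‖ * ‖w‖) ^ 2)).mono' ((hEc.mul ((hBc v w).pow 2)).aestronglyMeasurable) (ae_of_all _ fun ω => ?_)
    rw [Real.norm_eq_abs, abs_of_nonneg (mul_nonneg (exp_pos _).le (sq_nonneg _)), mul_comm ((κ₂ * ‖v‖ * ‖w‖) ^ 2)]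
    refine mul_le_mul_of_nonneg_left ?_ (exp_pos _).le
    rw [← sq_abs]; exact pow_le_pow_left₀ (abs_nonneg _) (hBb v w ω) 2
  · refine (((i4.const_mul 8).add (hI.const_mul (8 * ((∫ ω : EuclideanSpace ℝ ι, exp (-U (ω + ψ)) ∂(multivariateGaussian 0 M⁻¹))⁻¹ * (∫ ω : EuclideanSpace ℝ ι, exp (-U (ω +
      ψ)) * U' (ω + ψ) v ∂(multivariateGaussian 0 M⁻¹))) ^ 4))).mono') ((hEc.mul (((hAc v).sub continuous_const).pow 4)).aestronglyMeasurable)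
      (ae_of_all _ fun ω => ?_)
    rw [Real.norm_eq_abs, abs_of_nonneg (mul_nonneg (exp_pos _).le (by positivity)), Pi.add_apply]
    have hA4 : U' (ω + ψ) v ^ 4 ≤ ‖U' (ω + ψ)‖ ^ 4 := by
      have h := pow_le_pow_left₀ (abs_nonneg _) (hAb v ω) 4
      rw [hv, mul_one, ← abs_pow, abs_of_nonneg (by positivity)] at h; exact h
    have h8 : (U' (ω + ψ) v - ((∫ ω : EuclideanSpace ℝ ι, exp (-U (ω + ψ)) ∂(multivariateGaussian 0 M⁻¹))⁻¹ * (∫ ω : EuclideanSpace ℝ ι, exp (-U (ω + ψ)) * U' (ω + ψ) v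
        ∂(multivariateGaussian 0 M⁻¹)))) ^ 4 ≤ 8 * U' (ω + ψ) v ^ 4 + 8 * ((∫ ω : EuclideanSpace ℝ ι, exp (-U (ω + ψ)) ∂(multivariateGaussian 0 M⁻¹))⁻¹ * (∫ ω :
        EuclideanSpace ℝ ι, exp (-U (ω + ψ)) * U' (ω + ψ) v ∂(multivariateGaussian 0 M⁻¹))) ^ 4 := by
      nlinarith [sq_nonneg (U' (ω + ψ) v + ((∫ ω : EuclideanSpace ℝ ι, exp (-U (ω + ψ)) ∂(multivariateGaussian 0 M⁻¹))⁻¹ * (∫ ω : EuclideanSpace ℝ ι, exp (-U (ω + ψ)) * U'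
          (ω + ψ) v ∂(multivariateGaussian 0 M⁻¹)))), sq_nonneg (U' (ω + ψ) v - ((∫ ω : EuclideanSpace ℝ ι, exp (-U (ω + ψ)) ∂(multivariateGaussian 0 M⁻¹))⁻¹ * (∫ ω :
          EuclideanSpace ℝ ι, exp (-U (ω + ψ)) * U' (ω + ψ) v ∂(multivariateGaussian 0 M⁻¹)))), sq_nonneg (U' (ω + ψ) v ^ 2 - ((∫ ω : EuclideanSpace ℝ ι, exp (-U (ω + ψ))
          ∂(multivariateGaussian 0 M⁻¹))⁻¹ * (∫ ω : EuclideanSpace ℝ ι, exp (-U (ω + ψ)) * U' (ω + ψ) v ∂(multivariateGaussian 0 M⁻¹))) ^ 2),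
        sq_nonneg (U' (ω + ψ) v * ((∫ ω : EuclideanSpace ℝ ι, exp (-U (ω + ψ)) ∂(multivariateGaussian 0 M⁻¹))⁻¹ * (∫ ω : EuclideanSpace ℝ ι, exp (-U (ω + ψ)) * U' (ω + ψ) v
            ∂(multivariateGaussian 0 M⁻¹))))]
    nlinarith [exp_pos (-U (ω + ψ)), mul_le_mul_of_nonneg_left h8 (exp_pos (-U (ω + ψ))).le, mul_le_mul_of_nonneg_left hA4 (exp_pos (-U (ω + ψ))).le]

/-- **The tilted letters of the majorant's pieces for unit directions**: `Z⁻¹∫e(A_v−a_v)² ≤ κ₂²∕(m−λ)`, `Z⁻¹∫eB_vw² ≤ κ₂²`,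
`Z⁻¹∫e(A_v−a_v)⁴ ≤ 5κ₂⁴∕(m−λ)²` ((423)). [folklore] -/
theorem tilted_centred_letters (hM : M.PosDef) (hfl : ∀ z : ι → ℝ, m * ∑ i, z i ^ 2 ≤ z ⬝ᵥ (M *ᵥ z)) (hΓop : (γop • (1 : Matrix ι ι ℝ) - M⁻¹).PosSemidef) (Y : Finset ι)
    (hUd : ∀ φ : EuclideanSpace ℝ ι, HasFDerivAt U (U' φ) φ) (hU'd : ∀ φ : EuclideanSpace ℝ ι, HasFDerivAt U' (U'' φ) φ)
    (hU''d : ∀ φ : EuclideanSpace ℝ ι, HasFDerivAt U'' (U₃ φ) φ) (hU₃c : Continuous U₃) (hκ₀ : 0 ≤ κ₀) (hκ₁ : 0 ≤ κ₁) (ha : 0 ≤ a) (hτ : 0 < τ) (hδ : 0 < δ)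
    (hθ0 : 0 < θ) (hθ1 : θ < 1) (hκθ : (2 * κ₀ * (1 + τ) + 4 * δ) * γop ≤ θ) (hstab : ∀ φ : EuclideanSpace ℝ ι, -(κ₀ * ∑ x ∈ Y, φ x ^ 2) ≤ U φ)
    (hU'b : ∀ φ : EuclideanSpace ℝ ι, ‖U' φ‖ ≤ κ₁ * (a + ∑ x ∈ Y, φ x ^ 2)) (hU''b : ∀ φ : EuclideanSpace ℝ ι, ‖U'' φ‖ ≤ κ₂)
    (hU₃b : ∀ φ : EuclideanSpace ℝ ι, ‖U₃ φ‖ ≤ κ₃) (hlam : 0 ≤ lam)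
    (hUsec : ∀ s : ℝ, 0 ≤ s → s ≤ 1 → ∀ a b : EuclideanSpace ℝ ι,
      U ((1 - s) • a + s • b) - lam / 2 * (s * (1 - s)) * ∑ i, (a i - b i) ^ 2 ≤ (1 - s) * U a + s * U b)
    (hρ : lam < m) (ψ : EuclideanSpace ℝ ι) :
    (∀ v : EuclideanSpace ℝ ι, ‖v‖ = 1 → (∫ ω : EuclideanSpace ℝ ι, exp (-U (ω + ψ)) ∂(multivariateGaussian 0 M⁻¹))⁻¹ * (∫ ω : EuclideanSpace ℝ ι, exp (-U (ω + ψ)) * (U' (ω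
        + ψ) v - ((∫ ω : EuclideanSpace ℝ ι, exp (-U (ω + ψ)) ∂(multivariateGaussian 0 M⁻¹))⁻¹ * (∫ ω : EuclideanSpace ℝ ι, exp (-U (ω + ψ)) * U' (ω + ψ) v
        ∂(multivariateGaussian 0 M⁻¹)))) ^ 2 ∂(multivariateGaussian 0 M⁻¹)) ≤ κ₂ ^ 2 / (m - lam)) ∧
      (∀ v w : EuclideanSpace ℝ ι, ‖v‖ = 1 → ‖w‖ = 1 → (∫ ω : EuclideanSpace ℝ ι, exp (-U (ω + ψ)) ∂(multivariateGaussian 0 M⁻¹))⁻¹ * (∫ ω : EuclideanSpace ℝ ι, exp (-U (ω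
          + ψ)) * (U'' (ω + ψ) v w) ^ 2 ∂(multivariateGaussian 0 M⁻¹)) ≤ κ₂ ^ 2) ∧
      (∀ v : EuclideanSpace ℝ ι, ‖v‖ = 1 → (∫ ω : EuclideanSpace ℝ ι, exp (-U (ω + ψ)) ∂(multivariateGaussian 0 M⁻¹))⁻¹ * (∫ ω : EuclideanSpace ℝ ι, exp (-U (ω + ψ)) * (U'
          (ω + ψ) v - ((∫ ω : EuclideanSpace ℝ ι, exp (-U (ω + ψ)) ∂(multivariateGaussian 0 M⁻¹))⁻¹ * (∫ ω : EuclideanSpace ℝ ι, exp (-U (ω + ψ)) * U' (ω + ψ) v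
          ∂(multivariateGaussian 0 M⁻¹)))) ^ 4 ∂(multivariateGaussian 0 M⁻¹)) ≤ 5 * κ₂ ^ 4 / (m - lam) ^ 2) := by
  have hΓ : (M⁻¹).PosSemidef := hM.inv.posSemidef
  have hU''c : Continuous U'' := continuous_iff_continuousAt.2 fun φ => (hU''d φ).continuousAt
  have hUc : Continuous U := continuous_iff_continuousAt.2 fun φ => (hUd φ).continuousAt
  have hκθ₀ : 2 * κ₀ * (1 + τ) * γop ≤ θ := mul_opBound_le_of_le (by positivity) (by linarith) hθ0.le hκθ
  have hI := integrable_exp_neg_block hΓ hΓop Y hUc.measurable hκ₀ hτ hθ1 hκθ₀ hstab ψ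
  have hZ : 0 < (∫ ω : EuclideanSpace ℝ ι, exp (-U (ω + ψ)) ∂(multivariateGaussian 0 M⁻¹)) := integral_exp_pos hI
  obtain ⟨-, iBB, -⟩ := integrable_centred_pieces hM hΓop Y hUd hU'd hU''d hU₃c hκ₀ hκ₁ ha hτ hδ hθ0 hθ1 hκθ hstab hU'b hU''b hU₃b ψ
  refine ⟨fun v hv => ?_, fun v w hv hw => ?_, fun v hv => ?_⟩
  · rw [tilted_variance_eq hM hΓop Y hUd hU'd hκ₀ hκ₁ ha hτ hδ hθ0 hθ1 hκθ hstab hU'b ψ v]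
    have h := block_tilted_variance_le hM hfl hΓop Y hUd hU'd hU''c hκ₀ hκ₁ ha hτ hδ hθ0 hθ1 hκθ hstab hU'b hU''b hlam hUsec hρ ψ v
    rw [hv, one_pow, mul_one] at h; exact h
  · have hBb : ∀ ω : EuclideanSpace ℝ ι, exp (-U (ω + ψ)) * (U'' (ω + ψ) v w) ^ 2 ≤ exp (-U (ω + ψ)) * κ₂ ^ 2 := fun ω => by
      refine mul_le_mul_of_nonneg_left ?_ (exp_pos _).le
      have h1 : ‖U'' (ω + ψ) v w‖ ≤ κ₂ := by
        calc ‖U'' (ω + ψ) v w‖ ≤ ‖U'' (ω + ψ)‖ * ‖v‖ * ‖w‖ := ContinuousLinearMap.le_opNorm₂ _ _ _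
          _ ≤ κ₂ * ‖v‖ * ‖w‖ := by gcongr; exact hU''b _
          _ = κ₂ := by rw [hv, hw, mul_one, mul_one]
      rw [Real.norm_eq_abs] at h1
      rw [← sq_abs]; exact pow_le_pow_left₀ (abs_nonneg _) h1 2
    have h1 := integral_mono (iBB v w) (hI.mul_const _) hBb
    rw [integral_mul_const] at h1
    calc (∫ ω : EuclideanSpace ℝ ι, exp (-U (ω + ψ)) ∂(multivariateGaussian 0 M⁻¹))⁻¹ * (∫ ω : EuclideanSpace ℝ ι, exp (-U (ω + ψ)) * (U'' (ω + ψ) v w) ^ 2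
        ∂(multivariateGaussian 0 M⁻¹)) ≤ (∫ ω : EuclideanSpace ℝ ι, exp (-U (ω + ψ)) ∂(multivariateGaussian 0 M⁻¹))⁻¹ * ((∫ ω : EuclideanSpace ℝ ι, exp (-U (ω + ψ))
        ∂(multivariateGaussian 0 M⁻¹)) * κ₂ ^ 2) := mul_le_mul_of_nonneg_left h1 (inv_nonneg.2 hZ.le)
      _ = κ₂ ^ 2 := by rw [← mul_assoc, inv_mul_cancel₀ hZ.ne', one_mul]
  · have h := block_tilted_fourth_moment_le hM hfl hΓop Y hUd hU'd hU''c hκ₀ hκ₁ ha hτ hδ hθ0 hθ1 hκθ hstab hU'b hU''b hlam hUsec hρ ψ v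
    rw [hv, one_pow, mul_one] at h; exact h

/-! ## §3. THE END: the uniform third-order letter -/

/-- **The centred integral is dominated**: for unit `h,k,l`,
`|∫e·Ψ| ≤ κ₃Z + ½∫eÃk² + ½∫eB_hl² + ½∫eB_hk² + ½∫eÃl² + ½∫eÃh² + ½∫eB_kl² + ½∫eÃh² + ¼∫eÃk⁴ + ¼∫eÃl⁴`. [folklore] -/
theorem centred_integral_abs_le (hM : M.PosDef) (hΓop : (γop • (1 : Matrix ι ι ℝ) - M⁻¹).PosSemidef) (Y : Finset ι)
    (hUd : ∀ φ : EuclideanSpace ℝ ι, HasFDerivAt U (U' φ) φ) (hU'd : ∀ φ : EuclideanSpace ℝ ι, HasFDerivAt U' (U'' φ) φ)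
    (hU''d : ∀ φ : EuclideanSpace ℝ ι, HasFDerivAt U'' (U₃ φ) φ) (hU₃c : Continuous U₃) (hκ₀ : 0 ≤ κ₀) (hκ₁ : 0 ≤ κ₁) (ha : 0 ≤ a) (hτ : 0 < τ) (hδ : 0 < δ)
    (hθ0 : 0 < θ) (hθ1 : θ < 1) (hκθ : (2 * κ₀ * (1 + τ) + 4 * δ) * γop ≤ θ) (hstab : ∀ φ : EuclideanSpace ℝ ι, -(κ₀ * ∑ x ∈ Y, φ x ^ 2) ≤ U φ)
    (hU'b : ∀ φ : EuclideanSpace ℝ ι, ‖U' φ‖ ≤ κ₁ * (a + ∑ x ∈ Y, φ x ^ 2)) (hU''b : ∀ φ : EuclideanSpace ℝ ι, ‖U'' φ‖ ≤ κ₂)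
    (hU₃b : ∀ φ : EuclideanSpace ℝ ι, ‖U₃ φ‖ ≤ κ₃) (ψ h k l : EuclideanSpace ℝ ι)
    (hh : ‖h‖ = 1) (hk : ‖k‖ = 1) (hl : ‖l‖ = 1) :
    |(∫ ω : EuclideanSpace ℝ ι, exp (-U (ω + ψ)) * (U₃ (ω + ψ) h k l - (U' (ω + ψ) k - ((∫ ω : EuclideanSpace ℝ ι, exp (-U (ω + ψ)) ∂(multivariateGaussian 0 M⁻¹))⁻¹ * (∫ ω
        : EuclideanSpace ℝ ι, exp (-U (ω + ψ)) * U' (ω + ψ) k ∂(multivariateGaussian 0 M⁻¹)))) * U'' (ω + ψ) h l - U'' (ω + ψ) h k * (U' (ω + ψ) l - ((∫ ω : EuclideanSpace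
        ℝ ι, exp (-U (ω + ψ)) ∂(multivariateGaussian 0 M⁻¹))⁻¹ * (∫ ω : EuclideanSpace ℝ ι, exp (-U (ω + ψ)) * U' (ω + ψ) l ∂(multivariateGaussian 0 M⁻¹)))) - (U' (ω + ψ) h
        - ((∫ ω : EuclideanSpace ℝ ι, exp (-U (ω + ψ)) ∂(multivariateGaussian 0 M⁻¹))⁻¹ * (∫ ω : EuclideanSpace ℝ ι, exp (-U (ω + ψ)) * U' (ω + ψ) h ∂(multivariateGaussian
        0 M⁻¹)))) * U'' (ω + ψ) k l + (U' (ω + ψ) h - ((∫ ω : EuclideanSpace ℝ ι, exp (-U (ω + ψ)) ∂(multivariateGaussian 0 M⁻¹))⁻¹ * (∫ ω : EuclideanSpace ℝ ι, exp (-U (ω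
        + ψ)) * U' (ω + ψ) h ∂(multivariateGaussian 0 M⁻¹)))) * (U' (ω + ψ) k - ((∫ ω : EuclideanSpace ℝ ι, exp (-U (ω + ψ)) ∂(multivariateGaussian 0 M⁻¹))⁻¹ * (∫ ω :
        EuclideanSpace ℝ ι, exp (-U (ω + ψ)) * U' (ω + ψ) k ∂(multivariateGaussian 0 M⁻¹)))) * (U' (ω + ψ) l - ((∫ ω : EuclideanSpace ℝ ι, exp (-U (ω + ψ))
        ∂(multivariateGaussian 0 M⁻¹))⁻¹ * (∫ ω : EuclideanSpace ℝ ι, exp (-U (ω + ψ)) * U' (ω + ψ) l ∂(multivariateGaussian 0 M⁻¹))))) ∂(multivariateGaussian 0 M⁻¹))| ≤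
      κ₃ * (∫ ω : EuclideanSpace ℝ ι, exp (-U (ω + ψ)) ∂(multivariateGaussian 0 M⁻¹)) + 1 / 2 * (∫ ω : EuclideanSpace ℝ ι, exp (-U (ω + ψ)) * (U' (ω + ψ) k - ((∫ ω :
          EuclideanSpace ℝ ι, exp (-U (ω + ψ)) ∂(multivariateGaussian 0 M⁻¹))⁻¹ * (∫ ω : EuclideanSpace ℝ ι, exp (-U (ω + ψ)) * U' (ω + ψ) k ∂(multivariateGaussian 0
          M⁻¹)))) ^ 2 ∂(multivariateGaussian 0 M⁻¹)) + 1 / 2 * (∫ ω : EuclideanSpace ℝ ι, exp (-U (ω + ψ)) * (U'' (ω + ψ) h l) ^ 2 ∂(multivariateGaussian 0 M⁻¹)) + 1 / 2 *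
          (∫ ω : EuclideanSpace ℝ ι, exp (-U (ω + ψ)) * (U'' (ω + ψ) h k) ^ 2 ∂(multivariateGaussian 0 M⁻¹)) + 1 / 2 * (∫ ω : EuclideanSpace ℝ ι, exp (-U (ω + ψ)) * (U' (ω
          + ψ) l - ((∫ ω : EuclideanSpace ℝ ι, exp (-U (ω + ψ)) ∂(multivariateGaussian 0 M⁻¹))⁻¹ * (∫ ω : EuclideanSpace ℝ ι, exp (-U (ω + ψ)) * U' (ω + ψ) l
          ∂(multivariateGaussian 0 M⁻¹)))) ^ 2 ∂(multivariateGaussian 0 M⁻¹)) + 1 / 2 * (∫ ω : EuclideanSpace ℝ ι, exp (-U (ω + ψ)) * (U' (ω + ψ) h - ((∫ ω : EuclideanSpace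
          ℝ ι, exp (-U (ω + ψ)) ∂(multivariateGaussian 0 M⁻¹))⁻¹ * (∫ ω : EuclideanSpace ℝ ι, exp (-U (ω + ψ)) * U' (ω + ψ) h ∂(multivariateGaussian 0 M⁻¹)))) ^ 2
          ∂(multivariateGaussian 0 M⁻¹)) + 1 / 2 * (∫ ω : EuclideanSpace ℝ ι, exp (-U (ω + ψ)) * (U'' (ω + ψ) k l) ^ 2 ∂(multivariateGaussian 0 M⁻¹)) + 1 / 2 * (∫ ω :
          EuclideanSpace ℝ ι, exp (-U (ω + ψ)) * (U' (ω + ψ) h - ((∫ ω : EuclideanSpace ℝ ι, exp (-U (ω + ψ)) ∂(multivariateGaussian 0 M⁻¹))⁻¹ * (∫ ω : EuclideanSpace ℝ ι,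
          exp (-U (ω + ψ)) * U' (ω + ψ) h ∂(multivariateGaussian 0 M⁻¹)))) ^ 2 ∂(multivariateGaussian 0 M⁻¹)) + 1 / 4 * (∫ ω : EuclideanSpace ℝ ι, exp (-U (ω + ψ)) * (U' (ω
          + ψ) k - ((∫ ω : EuclideanSpace ℝ ι, exp (-U (ω + ψ)) ∂(multivariateGaussian 0 M⁻¹))⁻¹ * (∫ ω : EuclideanSpace ℝ ι, exp (-U (ω + ψ)) * U' (ω + ψ) k
          ∂(multivariateGaussian 0 M⁻¹)))) ^ 4 ∂(multivariateGaussian 0 M⁻¹)) + 1 / 4 * (∫ ω : EuclideanSpace ℝ ι, exp (-U (ω + ψ)) * (U' (ω + ψ) l - ((∫ ω : EuclideanSpace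
          ℝ ι, exp (-U (ω + ψ)) ∂(multivariateGaussian 0 M⁻¹))⁻¹ * (∫ ω : EuclideanSpace ℝ ι, exp (-U (ω + ψ)) * U' (ω + ψ) l ∂(multivariateGaussian 0 M⁻¹)))) ^ 4
          ∂(multivariateGaussian 0 M⁻¹)) := by
  have hΓ : (M⁻¹).PosSemidef := hM.inv.posSemidef
  have hUc : Continuous U := continuous_iff_continuousAt.2 fun φ => (hUd φ).continuousAt
  have hκθ₀ : 2 * κ₀ * (1 + τ) * γop ≤ θ := mul_opBound_le_of_le (by positivity) (by linarith) hθ0.le hκθ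
  have hI := integrable_exp_neg_block hΓ hΓop Y hUc.measurable hκ₀ hτ hθ1 hκθ₀ hstab ψ
  obtain ⟨iV, iBB, iM⟩ := integrable_centred_pieces hM hΓop Y hUd hU'd hU''d hU₃c hκ₀ hκ₁ ha hτ hδ hθ0 hθ1 hκθ hstab hU'b hU''b hU₃b ψ
  -- `|C| ≤ κ₃` for unit directions
  have hC : ∀ ω : EuclideanSpace ℝ ι, |U₃ (ω + ψ) h k l| ≤ κ₃ := fun ω => by
    rw [← Real.norm_eq_abs]
    calc ‖U₃ (ω + ψ) h k l‖ ≤ ‖U₃ (ω + ψ) h k‖ * ‖l‖ := ContinuousLinearMap.le_opNorm _ _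
      _ ≤ ‖U₃ (ω + ψ) h‖ * ‖k‖ * ‖l‖ := by gcongr; exact ContinuousLinearMap.le_opNorm _ _
      _ ≤ ‖U₃ (ω + ψ)‖ * ‖h‖ * ‖k‖ * ‖l‖ := by gcongr; exact ContinuousLinearMap.le_opNorm _ _
      _ ≤ κ₃ * ‖h‖ * ‖k‖ * ‖l‖ := by gcongr; exact hU₃b _
      _ = κ₃ := by rw [hh, hk, hl]; ring
  -- the pointwise majorant
  have hmaj : ∀ ω : EuclideanSpace ℝ ι, |exp (-U (ω + ψ)) * (U₃ (ω + ψ) h k l - (U' (ω + ψ) k - ((∫ ω : EuclideanSpace ℝ ι, exp (-U (ω + ψ)) ∂(multivariateGaussian 0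
      M⁻¹))⁻¹ * (∫ ω : EuclideanSpace ℝ ι, exp (-U (ω + ψ)) * U' (ω + ψ) k ∂(multivariateGaussian 0 M⁻¹)))) * U'' (ω + ψ) h l - U'' (ω + ψ) h k * (U' (ω + ψ) l - ((∫ ω :
      EuclideanSpace ℝ ι, exp (-U (ω + ψ)) ∂(multivariateGaussian 0 M⁻¹))⁻¹ * (∫ ω : EuclideanSpace ℝ ι, exp (-U (ω + ψ)) * U' (ω + ψ) l ∂(multivariateGaussian 0 M⁻¹)))) -
      (U' (ω + ψ) h - ((∫ ω : EuclideanSpace ℝ ι, exp (-U (ω + ψ)) ∂(multivariateGaussian 0 M⁻¹))⁻¹ * (∫ ω : EuclideanSpace ℝ ι, exp (-U (ω + ψ)) * U' (ω + ψ) h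
      ∂(multivariateGaussian 0 M⁻¹)))) * U'' (ω + ψ) k l + (U' (ω + ψ) h - ((∫ ω : EuclideanSpace ℝ ι, exp (-U (ω + ψ)) ∂(multivariateGaussian 0 M⁻¹))⁻¹ * (∫ ω :
      EuclideanSpace ℝ ι, exp (-U (ω + ψ)) * U' (ω + ψ) h ∂(multivariateGaussian 0 M⁻¹)))) * (U' (ω + ψ) k - ((∫ ω : EuclideanSpace ℝ ι, exp (-U (ω + ψ))
      ∂(multivariateGaussian 0 M⁻¹))⁻¹ * (∫ ω : EuclideanSpace ℝ ι, exp (-U (ω + ψ)) * U' (ω + ψ) k ∂(multivariateGaussian 0 M⁻¹)))) * (U' (ω + ψ) l - ((∫ ω :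
      EuclideanSpace ℝ ι, exp (-U (ω + ψ)) ∂(multivariateGaussian 0 M⁻¹))⁻¹ * (∫ ω : EuclideanSpace ℝ ι, exp (-U (ω + ψ)) * U' (ω + ψ) l ∂(multivariateGaussian 0 M⁻¹)))))|
      ≤
      exp (-U (ω + ψ)) * (κ₃ + ((U' (ω + ψ) k - ((∫ ω : EuclideanSpace ℝ ι, exp (-U (ω + ψ)) ∂(multivariateGaussian 0 M⁻¹))⁻¹ * (∫ ω : EuclideanSpace ℝ ι, exp (-U (ω + ψ))
          * U' (ω + ψ) k ∂(multivariateGaussian 0 M⁻¹)))) ^ 2 + (U'' (ω + ψ) h l) ^ 2) / 2 + ((U'' (ω + ψ) h k) ^ 2 + (U' (ω + ψ) l - ((∫ ω : EuclideanSpace ℝ ι, exp (-U (ω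
          + ψ)) ∂(multivariateGaussian 0 M⁻¹))⁻¹ * (∫ ω : EuclideanSpace ℝ ι, exp (-U (ω + ψ)) * U' (ω + ψ) l ∂(multivariateGaussian 0 M⁻¹)))) ^ 2) / 2 + ((U' (ω + ψ) h -
          ((∫ ω : EuclideanSpace ℝ ι, exp (-U (ω + ψ)) ∂(multivariateGaussian 0 M⁻¹))⁻¹ * (∫ ω : EuclideanSpace ℝ ι, exp (-U (ω + ψ)) * U' (ω + ψ) h ∂(multivariateGaussian
          0 M⁻¹)))) ^ 2 + (U'' (ω + ψ) k l) ^ 2) / 2 + (U' (ω + ψ) h - ((∫ ω : EuclideanSpace ℝ ι, exp (-U (ω + ψ)) ∂(multivariateGaussian 0 M⁻¹))⁻¹ * (∫ ω : EuclideanSpace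
          ℝ ι, exp (-U (ω + ψ)) * U' (ω + ψ) h ∂(multivariateGaussian 0 M⁻¹)))) ^ 2 / 2 + ((U' (ω + ψ) k - ((∫ ω : EuclideanSpace ℝ ι, exp (-U (ω + ψ))
          ∂(multivariateGaussian 0 M⁻¹))⁻¹ * (∫ ω : EuclideanSpace ℝ ι, exp (-U (ω + ψ)) * U' (ω + ψ) k ∂(multivariateGaussian 0 M⁻¹)))) ^ 4 + (U' (ω + ψ) l - ((∫ ω :
          EuclideanSpace ℝ ι, exp (-U (ω + ψ)) ∂(multivariateGaussian 0 M⁻¹))⁻¹ * (∫ ω : EuclideanSpace ℝ ι, exp (-U (ω + ψ)) * U' (ω + ψ) l ∂(multivariateGaussian 0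
          M⁻¹)))) ^ 4) / 4) := fun ω => by
    rw [abs_mul, abs_of_pos (exp_pos _)]
    exact mul_le_mul_of_nonneg_left (psi_abs_le (hC ω)) (exp_pos _).le
  obtain ⟨hint_i, hint_eq⟩ := integral_majorant_split (multivariateGaussian 0 M⁻¹) (fun ω : EuclideanSpace ℝ ι => exp (-U (ω + ψ))) (fun ω : EuclideanSpace ℝ ι => (U' (ω +
      ψ) k - ((∫ ω : EuclideanSpace ℝ ι, exp (-U (ω + ψ)) ∂(multivariateGaussian 0 M⁻¹))⁻¹ * (∫ ω : EuclideanSpace ℝ ι, exp (-U (ω + ψ)) * U' (ω + ψ) k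
      ∂(multivariateGaussian 0 M⁻¹))))) (fun ω : EuclideanSpace ℝ ι => (U' (ω + ψ) l - ((∫ ω : EuclideanSpace ℝ ι, exp (-U (ω + ψ)) ∂(multivariateGaussian 0 M⁻¹))⁻¹ * (∫ ω
      : EuclideanSpace ℝ ι, exp (-U (ω + ψ)) * U' (ω + ψ) l ∂(multivariateGaussian 0 M⁻¹))))) (fun ω : EuclideanSpace ℝ ι => (U' (ω + ψ) h - ((∫ ω : EuclideanSpace ℝ ι, exp
      (-U (ω + ψ)) ∂(multivariateGaussian 0 M⁻¹))⁻¹ * (∫ ω : EuclideanSpace ℝ ι, exp (-U (ω + ψ)) * U' (ω + ψ) h ∂(multivariateGaussian 0 M⁻¹)))))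
    (fun ω : EuclideanSpace ℝ ι => U'' (ω + ψ) h l) (fun ω : EuclideanSpace ℝ ι => U'' (ω + ψ) h k) (fun ω : EuclideanSpace ℝ ι => U'' (ω + ψ) k l) κ₃ hI (iV k) (iV l) (iV
        h) (iBB h l) (iBB h k) (iBB k l) (iM k hk) (iM l hl)
  exact abs_integral_le_integral_abs.trans ((integral_mono_of_nonneg (ae_of_all _ fun ω => abs_nonneg _) hint_i (ae_of_all _ hmaj)).trans_eq hint_eq)

/-- **`|T(ψ)[h,k,l]| ≤ κ₃⁺` for unit directions**, `κ₃⁺ = κ₃ + 3κ₂²∕2 + 2κ₂²∕(m−λ) + 5κ₂⁴∕(2(m−λ)²)`. [folklore] -/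
theorem third_deriv_apply_le (hM : M.PosDef) (hfl : ∀ z : ι → ℝ, m * ∑ i, z i ^ 2 ≤ z ⬝ᵥ (M *ᵥ z)) (hΓop : (γop • (1 : Matrix ι ι ℝ) - M⁻¹).PosSemidef) (Y : Finset ι)
    (hUd : ∀ φ : EuclideanSpace ℝ ι, HasFDerivAt U (U' φ) φ) (hU'd : ∀ φ : EuclideanSpace ℝ ι, HasFDerivAt U' (U'' φ) φ)
    (hU''d : ∀ φ : EuclideanSpace ℝ ι, HasFDerivAt U'' (U₃ φ) φ) (hU₃c : Continuous U₃) (hκ₀ : 0 ≤ κ₀) (hκ₁ : 0 ≤ κ₁) (ha : 0 ≤ a) (hκ₂ : 0 ≤ κ₂) (hκ₃ : 0 ≤ κ₃) (hτ : 0 <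
        τ) (hδ : 0 < δ)
    (hθ0 : 0 < θ) (hθ1 : θ < 1) (hκθ : (2 * κ₀ * (1 + τ) + 4 * δ) * γop ≤ θ) (hstab : ∀ φ : EuclideanSpace ℝ ι, -(κ₀ * ∑ x ∈ Y, φ x ^ 2) ≤ U φ)
    (hU'b : ∀ φ : EuclideanSpace ℝ ι, ‖U' φ‖ ≤ κ₁ * (a + ∑ x ∈ Y, φ x ^ 2)) (hU''b : ∀ φ : EuclideanSpace ℝ ι, ‖U'' φ‖ ≤ κ₂)
    (hU₃b : ∀ φ : EuclideanSpace ℝ ι, ‖U₃ φ‖ ≤ κ₃) (hlam : 0 ≤ lam)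
    (hUsec : ∀ s : ℝ, 0 ≤ s → s ≤ 1 → ∀ a b : EuclideanSpace ℝ ι,
      U ((1 - s) • a + s • b) - lam / 2 * (s * (1 - s)) * ∑ i, (a i - b i) ^ 2 ≤ (1 - s) * U a + s * U b)
    (hρ : lam < m) (ψ h k l : EuclideanSpace ℝ ι)
    (hh : ‖h‖ = 1) (hk : ‖k‖ = 1) (hl : ‖l‖ = 1) :
    |(((∫ ω : EuclideanSpace ℝ ι, exp (-U (ω + ψ)) ∂(multivariateGaussian 0 M⁻¹))⁻¹ • (∫ ω : EuclideanSpace ℝ ι, (exp (-U (ω + ψ)) • (U₃ (ω + ψ) -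
        (((ContinuousLinearMap.smulRightL ℝ (EuclideanSpace ℝ ι) (EuclideanSpace ℝ ι →L[ℝ] ℝ)) (U' (ω + ψ))).comp (U'' (ω + ψ)) + (((ContinuousLinearMap.smulRightL ℝ
        (EuclideanSpace ℝ ι) (EuclideanSpace ℝ ι →L[ℝ] ℝ))).comp (U'' (ω + ψ))).flip (U' (ω + ψ)))) + (exp (-U (ω + ψ)) • -U' (ω + ψ)).smulRight (U'' (ω + ψ) - (U' (ω +
        ψ)).smulRight (U' (ω + ψ)))) ∂(multivariateGaussian 0 M⁻¹)) + ((-((∫ ω : EuclideanSpace ℝ ι, exp (-U (ω + ψ)) ∂(multivariateGaussian 0 M⁻¹)) ^ 2)⁻¹) • -(∫ ω :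
        EuclideanSpace ℝ ι, exp (-U (ω + ψ)) • U' (ω + ψ) ∂(multivariateGaussian 0 M⁻¹))).smulRight (∫ ω : EuclideanSpace ℝ ι, exp (-U (ω + ψ)) • (U'' (ω + ψ) - (U' (ω +
        ψ)).smulRight (U' (ω + ψ))) ∂(multivariateGaussian 0 M⁻¹))) + (((ContinuousLinearMap.smulRightL ℝ (EuclideanSpace ℝ ι) (EuclideanSpace ℝ ι →L[ℝ] ℝ)) (((∫ ω :
        EuclideanSpace ℝ ι, exp (-U (ω + ψ)) ∂(multivariateGaussian 0 M⁻¹)) ^ 2)⁻¹ • (∫ ω : EuclideanSpace ℝ ι, exp (-U (ω + ψ)) • U' (ω + ψ) ∂(multivariateGaussian 0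
        M⁻¹)))).comp (∫ ω : EuclideanSpace ℝ ι, exp (-U (ω + ψ)) • (U'' (ω + ψ) - (U' (ω + ψ)).smulRight (U' (ω + ψ))) ∂(multivariateGaussian 0 M⁻¹)) +
        (((ContinuousLinearMap.smulRightL ℝ (EuclideanSpace ℝ ι) (EuclideanSpace ℝ ι →L[ℝ] ℝ))).comp (((∫ ω : EuclideanSpace ℝ ι, exp (-U (ω + ψ)) ∂(multivariateGaussian 0
        M⁻¹)) ^ 2)⁻¹ • (∫ ω : EuclideanSpace ℝ ι, exp (-U (ω + ψ)) • (U'' (ω + ψ) - (U' (ω + ψ)).smulRight (U' (ω + ψ))) ∂(multivariateGaussian 0 M⁻¹)) + ((-2 / (∫ ω :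
        EuclideanSpace ℝ ι, exp (-U (ω + ψ)) ∂(multivariateGaussian 0 M⁻¹)) ^ 3) • -(∫ ω : EuclideanSpace ℝ ι, exp (-U (ω + ψ)) • U' (ω + ψ) ∂(multivariateGaussian 0
        M⁻¹))).smulRight (∫ ω : EuclideanSpace ℝ ι, exp (-U (ω + ψ)) • U' (ω + ψ) ∂(multivariateGaussian 0 M⁻¹)))).flip (∫ ω : EuclideanSpace ℝ ι, exp (-U (ω + ψ)) • U' (ω
        + ψ) ∂(multivariateGaussian 0 M⁻¹)))) h k l| ≤ (κ₃ + 3 * κ₂ ^ 2 / 2 + 2 * κ₂ ^ 2 / (m - lam) + 5 * κ₂ ^ 4 / (2 * (m - lam) ^ 2)) := by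
  have hΓ : (M⁻¹).PosSemidef := hM.inv.posSemidef
  have hUc : Continuous U := continuous_iff_continuousAt.2 fun φ => (hUd φ).continuousAt
  have hκθ₀ : 2 * κ₀ * (1 + τ) * γop ≤ θ := mul_opBound_le_of_le (by positivity) (by linarith) hθ0.le hκθ
  have hI := integrable_exp_neg_block hΓ hΓop Y hUc.measurable hκ₀ hτ hθ1 hκθ₀ hstab ψ
  have hZ : 0 < (∫ ω : EuclideanSpace ℝ ι, exp (-U (ω + ψ)) ∂(multivariateGaussian 0 M⁻¹)) := integral_exp_pos hI
  obtain ⟨lV, lB, lM⟩ := tilted_centred_letters hM hfl hΓop Y hUd hU'd hU''d hU₃c hκ₀ hκ₁ ha hτ hδ hθ0 hθ1 hκθ hstab hU'b hU''b hU₃b hlam hUsec hρ ψ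
  rw [hessW_deriv_apply_centred hM hΓop Y hUd hU'd hU''d hU₃c hκ₀ hκ₁ ha hκ₂ hκ₃ hτ hδ hθ0 hθ1 hκθ hstab hU'b hU''b hU₃b ψ h k l, abs_mul, abs_of_pos (inv_pos.2 hZ)]
  have hint := centred_integral_abs_le hM hΓop Y hUd hU'd hU''d hU₃c hκ₀ hκ₁ ha hτ hδ hθ0 hθ1 hκθ hstab hU'b hU''b hU₃b ψ h k l hh hk hl
  have hfin := assembly_arith hZ hint (lV k hk) (lB h l hh hl) (lB h k hh hk) (lV l hl) (lV h hh) (lB k l hk hl) (lM k hk) (lM l hl)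
  refine hfin.trans (le_of_eq ?_)
  rw [div_div, mul_comm ((m - lam) ^ 2) (2 : ℝ), mul_div_assoc (2 : ℝ) (κ₂ ^ 2) (m - lam)]

/-- **THE END — THE UNIFORM THIRD-ORDER LETTER**: `‖T(ψ)‖ ≤ κ₃⁺` at EVERY `ψ`, with `κ₃⁺ = κ₃ + 3κ₂²∕2 + 2κ₂²∕(m−λ) + 5κ₂⁴∕(2(m−λ)²)`
independent of `ψ` and of the volume — the input format's `hU₃b` for the output `(w⁺)‴(ζ) = T(ψ₀+ζ)`. [folklore] -/
theorem third_letter_uniform (hM : M.PosDef) (hfl : ∀ z : ι → ℝ, m * ∑ i, z i ^ 2 ≤ z ⬝ᵥ (M *ᵥ z)) (hΓop : (γop • (1 : Matrix ι ι ℝ) - M⁻¹).PosSemidef) (Y : Finset ι)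
    (hUd : ∀ φ : EuclideanSpace ℝ ι, HasFDerivAt U (U' φ) φ) (hU'd : ∀ φ : EuclideanSpace ℝ ι, HasFDerivAt U' (U'' φ) φ)
    (hU''d : ∀ φ : EuclideanSpace ℝ ι, HasFDerivAt U'' (U₃ φ) φ) (hU₃c : Continuous U₃) (hκ₀ : 0 ≤ κ₀) (hκ₁ : 0 ≤ κ₁) (ha : 0 ≤ a) (hκ₂ : 0 ≤ κ₂) (hκ₃ : 0 ≤ κ₃) (hτ : 0 <
        τ) (hδ : 0 < δ)
    (hθ0 : 0 < θ) (hθ1 : θ < 1) (hκθ : (2 * κ₀ * (1 + τ) + 4 * δ) * γop ≤ θ) (hstab : ∀ φ : EuclideanSpace ℝ ι, -(κ₀ * ∑ x ∈ Y, φ x ^ 2) ≤ U φ)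
    (hU'b : ∀ φ : EuclideanSpace ℝ ι, ‖U' φ‖ ≤ κ₁ * (a + ∑ x ∈ Y, φ x ^ 2)) (hU''b : ∀ φ : EuclideanSpace ℝ ι, ‖U'' φ‖ ≤ κ₂)
    (hU₃b : ∀ φ : EuclideanSpace ℝ ι, ‖U₃ φ‖ ≤ κ₃) (hlam : 0 ≤ lam)
    (hUsec : ∀ s : ℝ, 0 ≤ s → s ≤ 1 → ∀ a b : EuclideanSpace ℝ ι,
      U ((1 - s) • a + s • b) - lam / 2 * (s * (1 - s)) * ∑ i, (a i - b i) ^ 2 ≤ (1 - s) * U a + s * U b)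
    (hρ : lam < m) (ψ : EuclideanSpace ℝ ι) :
    ‖(((∫ ω : EuclideanSpace ℝ ι, exp (-U (ω + ψ)) ∂(multivariateGaussian 0 M⁻¹))⁻¹ • (∫ ω : EuclideanSpace ℝ ι, (exp (-U (ω + ψ)) • (U₃ (ω + ψ) -
        (((ContinuousLinearMap.smulRightL ℝ (EuclideanSpace ℝ ι) (EuclideanSpace ℝ ι →L[ℝ] ℝ)) (U' (ω + ψ))).comp (U'' (ω + ψ)) + (((ContinuousLinearMap.smulRightL ℝ
        (EuclideanSpace ℝ ι) (EuclideanSpace ℝ ι →L[ℝ] ℝ))).comp (U'' (ω + ψ))).flip (U' (ω + ψ)))) + (exp (-U (ω + ψ)) • -U' (ω + ψ)).smulRight (U'' (ω + ψ) - (U' (ω +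
        ψ)).smulRight (U' (ω + ψ)))) ∂(multivariateGaussian 0 M⁻¹)) + ((-((∫ ω : EuclideanSpace ℝ ι, exp (-U (ω + ψ)) ∂(multivariateGaussian 0 M⁻¹)) ^ 2)⁻¹) • -(∫ ω :
        EuclideanSpace ℝ ι, exp (-U (ω + ψ)) • U' (ω + ψ) ∂(multivariateGaussian 0 M⁻¹))).smulRight (∫ ω : EuclideanSpace ℝ ι, exp (-U (ω + ψ)) • (U'' (ω + ψ) - (U' (ω +
        ψ)).smulRight (U' (ω + ψ))) ∂(multivariateGaussian 0 M⁻¹))) + (((ContinuousLinearMap.smulRightL ℝ (EuclideanSpace ℝ ι) (EuclideanSpace ℝ ι →L[ℝ] ℝ)) (((∫ ω :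
        EuclideanSpace ℝ ι, exp (-U (ω + ψ)) ∂(multivariateGaussian 0 M⁻¹)) ^ 2)⁻¹ • (∫ ω : EuclideanSpace ℝ ι, exp (-U (ω + ψ)) • U' (ω + ψ) ∂(multivariateGaussian 0
        M⁻¹)))).comp (∫ ω : EuclideanSpace ℝ ι, exp (-U (ω + ψ)) • (U'' (ω + ψ) - (U' (ω + ψ)).smulRight (U' (ω + ψ))) ∂(multivariateGaussian 0 M⁻¹)) +
        (((ContinuousLinearMap.smulRightL ℝ (EuclideanSpace ℝ ι) (EuclideanSpace ℝ ι →L[ℝ] ℝ))).comp (((∫ ω : EuclideanSpace ℝ ι, exp (-U (ω + ψ)) ∂(multivariateGaussian 0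
        M⁻¹)) ^ 2)⁻¹ • (∫ ω : EuclideanSpace ℝ ι, exp (-U (ω + ψ)) • (U'' (ω + ψ) - (U' (ω + ψ)).smulRight (U' (ω + ψ))) ∂(multivariateGaussian 0 M⁻¹)) + ((-2 / (∫ ω :
        EuclideanSpace ℝ ι, exp (-U (ω + ψ)) ∂(multivariateGaussian 0 M⁻¹)) ^ 3) • -(∫ ω : EuclideanSpace ℝ ι, exp (-U (ω + ψ)) • U' (ω + ψ) ∂(multivariateGaussian 0
        M⁻¹))).smulRight (∫ ω : EuclideanSpace ℝ ι, exp (-U (ω + ψ)) • U' (ω + ψ) ∂(multivariateGaussian 0 M⁻¹)))).flip (∫ ω : EuclideanSpace ℝ ι, exp (-U (ω + ψ)) • U' (ω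
        + ψ) ∂(multivariateGaussian 0 M⁻¹))))‖ ≤ (κ₃ + 3 * κ₂ ^ 2 / 2 + 2 * κ₂ ^ 2 / (m - lam) + 5 * κ₂ ^ 4 / (2 * (m - lam) ^ 2)) := by
  have hρ0 : 0 < m - lam := sub_pos.2 hρ
  have hK : 0 ≤ (κ₃ + 3 * κ₂ ^ 2 / 2 + 2 * κ₂ ^ 2 / (m - lam) + 5 * κ₂ ^ 4 / (2 * (m - lam) ^ 2)) := by positivity
  refine ContinuousLinearMap.opNorm_le_of_unit_norm hK fun h hh => ?_
  refine ContinuousLinearMap.opNorm_le_of_unit_norm hK fun k hk => ?_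
  refine ContinuousLinearMap.opNorm_le_of_unit_norm hK fun l hl => ?_
  rw [Real.norm_eq_abs]
  exact third_deriv_apply_le hM hfl hΓop Y hUd hU'd hU''d hU₃c hκ₀ hκ₁ ha hκ₂ hκ₃ hτ hδ hθ0 hθ1 hκθ hstab hU'b hU''b hU₃b hlam hUsec hρ ψ h k l hh hk hl

end Main

end Summit.QuantumFields.BalabanUV.T4Continuum.NE7b.SupBlockThirdLetterUniform
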